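import Mathlib

/-!
# `NewtonUnitEquationsNewtonTauWeakLevelSetSplit` — weighted level sets split along a block decomposition

Registered stub `stub_levelSetSplit` of line `binomial-normal-form` (crux `NewtonTauWeak`,
stmt-ValiantsHypothesis-5904, lead c7, THEOREM W♯): the halving identity for weighted level sets of subset sums.

Setting.  Items `j : Fin N` carry weights `g j ∈ ℕ` and exponents `d j ∈ ℕ²` (`Fin 2 →₀ ℕ`); the weight-`v`
level set of subset sums is the finset `LS N g d v = {Σ_{j ∈ J} d j : J ⊆ Fin N, Σ_{j ∈ J} g j = v}`.
For `N = n₁ + n₂` the item set is the disjoint union of the first block (`Fin.castAdd n₂ : Fin n₁ → Fin N`)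
and the second block (`Fin.natAdd n₁ : Fin n₂ → Fin N`).

Claim (`stub_levelSetSplit`).
`LS (n₁ + n₂) g d v = ⋃_{v₁ ≤ v} (LS n₁ g₁ d₁ v₁ ⊕ LS n₂ g₂ d₂ (v - v₁))`, where `g₁ = g ∘ castAdd n₂`,
`g₂ = g ∘ natAdd n₁` (same for `d`) and `P ⊕ Q = (P ×ˢ Q).image (·.1 + ·.2)` is the Minkowski sum.

Proof.  A subset `J ⊆ Fin (n₁ + n₂)` is the disjoint union of the images of its two traces
`J₁ = {j : castAdd n₂ j ∈ J}` and `J₂ = {j : natAdd n₁ j ∈ J}` (`LevelSetSplitAux.glue_traces`), and every sum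
over a glued set `J₁.map castAddEmb ∪ J₂.map natAddEmb` splits as the sum of the two block sums
(`LevelSetSplitAux.sum_glue`, from `Finset.sum_union` + `Finset.sum_map`; the two images are disjoint since
`castAdd` lands below `n₁` and `natAdd` at or above `n₁`).  (⊆) take `v₁ = Σ_{J₁} g₁ ≤ v`; (⊇) glue the two
witnesses.  Everything is folklore finite bookkeeping; no named facts, no citations, no `def`s. [folklore]
-/

-- Sub = Summit single-conjunct layout: the duplicated namespace component is mandated by the tree.
set_option linter.dupNamespace false

noncomputable section

open scoped BigOperators

namespace Summit.ValiantsHypothesis.ValiantsHypothesis.Theorems.NewtonUnitEquationsNewtonTauWeak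

namespace LevelSetSplitAux

open Finset

/-- The images of the two blocks `Fin n₁ ↪ Fin (n₁ + n₂)` (on the left) and `Fin n₂ ↪ Fin (n₁ + n₂)` (on the
right) are disjoint: the first lands strictly below `n₁`, the second at or above `n₁`. [folklore] -/
theorem disjoint_map_blocks {n₁ n₂ : ℕ} (J₁ : Finset (Fin n₁)) (J₂ : Finset (Fin n₂)) :
    Disjoint (J₁.map (Fin.castAddEmb n₂)) (J₂.map (Fin.natAddEmb n₁)) := by
  rw [Finset.disjoint_left]
  intro i hi hi'
  obtain ⟨a, -, rfl⟩ := Finset.mem_map.1 hi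
  obtain ⟨b, -, hb⟩ := Finset.mem_map.1 hi'
  have h1 : (Fin.castAddEmb n₂ a : Fin (n₁ + n₂)).val < n₁ := by simp
  have h2 : n₁ ≤ (Fin.natAddEmb n₁ b : Fin (n₁ + n₂)).val := by simp
  rw [hb] at h2
  omega

/-- A sum over the glued set `J₁ ⊔ J₂ ⊆ Fin (n₁ + n₂)` is the sum of the two block sums. [folklore] -/
theorem sum_glue {M : Type*} [AddCommMonoid M] {n₁ n₂ : ℕ} (J₁ : Finset (Fin n₁)) (J₂ : Finset (Fin n₂))
    (f : Fin (n₁ + n₂) → M) :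
    ∑ j ∈ J₁.map (Fin.castAddEmb n₂) ∪ J₂.map (Fin.natAddEmb n₁), f j =
      ∑ j ∈ J₁, f (Fin.castAdd n₂ j) + ∑ j ∈ J₂, f (Fin.natAdd n₁ j) := by
  rw [Finset.sum_union (disjoint_map_blocks J₁ J₂), Finset.sum_map, Finset.sum_map]
  rfl

/-- Every subset of `Fin (n₁ + n₂)` is the glueing of its two block traces. [folklore] -/
theorem glue_traces {n₁ n₂ : ℕ} (J : Finset (Fin (n₁ + n₂))) :
    (Finset.univ.filter fun j : Fin n₁ => Fin.castAdd n₂ j ∈ J).map (Fin.castAddEmb n₂) ∪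
        (Finset.univ.filter fun j : Fin n₂ => Fin.natAdd n₁ j ∈ J).map (Fin.natAddEmb n₁) = J := by
  ext i
  simp only [Finset.mem_union, Finset.mem_map, Finset.mem_filter, Finset.mem_univ, true_and,
    Fin.castAddEmb_apply, Fin.natAddEmb_apply]
  constructor
  · rintro (⟨j, hj, rfl⟩ | ⟨j, hj, rfl⟩)
    · exact hj
    · exact hj
  · intro hi
    induction i using Fin.addCases with
    | left j => exact Or.inl ⟨j, hi, rfl⟩
    | right j => exact Or.inr ⟨j, hi, rfl⟩

/-- A sum over any `J ⊆ Fin (n₁ + n₂)` splits as the sum over its first-block trace plus the sum over its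
second-block trace. [folklore] -/
theorem sum_traces {M : Type*} [AddCommMonoid M] {n₁ n₂ : ℕ} (J : Finset (Fin (n₁ + n₂)))
    (f : Fin (n₁ + n₂) → M) :
    ∑ j ∈ J, f j =
      ∑ j ∈ (Finset.univ.filter fun j : Fin n₁ => Fin.castAdd n₂ j ∈ J), f (Fin.castAdd n₂ j) +
        ∑ j ∈ (Finset.univ.filter fun j : Fin n₂ => Fin.natAdd n₁ j ∈ J), f (Fin.natAdd n₁ j) := by
  conv_lhs => rw [← glue_traces J]
  exact sum_glue _ _ f

end LevelSetSplitAux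

open LevelSetSplitAux in
/-- **Weighted level sets split along a block decomposition (THEOREM W♯, halving step).**
For items `Fin (n₁ + n₂)` with weights `g` and exponents `d`, the weight-`v` level set of subset sums
`{Σ_{j ∈ J} d j : Σ_{j ∈ J} g j = v}` is the union over `v₁ ∈ [0, v]` of the Minkowski sums of the weight-`v₁`
level set of the first block (items `Fin.castAdd n₂ j`) and the weight-`(v - v₁)` level set of the second block
(items `Fin.natAdd n₁ j`). [folklore] -/
theorem stub_levelSetSplit (n₁ n₂ v : ℕ) (g : Fin (n₁ + n₂) → ℕ) (d : Fin (n₁ + n₂) → (Fin 2 →₀ ℕ)) :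
    ((Finset.univ.filter fun J : Finset (Fin (n₁ + n₂)) => ∑ j ∈ J, g j = v).image fun J => ∑ j ∈ J, d j) =
      (Finset.range (v + 1)).biUnion fun v₁ =>
        ((((Finset.univ.filter fun J : Finset (Fin n₁) => ∑ j ∈ J, g (Fin.castAdd n₂ j) = v₁).image
            fun J => ∑ j ∈ J, d (Fin.castAdd n₂ j)) ×ˢ
          ((Finset.univ.filter fun J : Finset (Fin n₂) => ∑ j ∈ J, g (Fin.natAdd n₁ j) = v - v₁).image
            fun J => ∑ j ∈ J, d (Fin.natAdd n₁ j))).image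
          fun pq : (Fin 2 →₀ ℕ) × (Fin 2 →₀ ℕ) => pq.1 + pq.2) := by
  ext p
  constructor
  · intro hp
    obtain ⟨J, hJ, rfl⟩ := Finset.mem_image.1 hp
    have hJv : ∑ j ∈ J, g j = v := (Finset.mem_filter.1 hJ).2
    have hg := sum_traces J g
    have hd := sum_traces J d
    refine Finset.mem_biUnion.2
      ⟨∑ j ∈ (Finset.univ.filter fun j : Fin n₁ => Fin.castAdd n₂ j ∈ J), g (Fin.castAdd n₂ j), ?_, ?_⟩
    · rw [Finset.mem_range]
      omega
    · refine Finset.mem_image.2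
        ⟨(∑ j ∈ (Finset.univ.filter fun j : Fin n₁ => Fin.castAdd n₂ j ∈ J), d (Fin.castAdd n₂ j),
          ∑ j ∈ (Finset.univ.filter fun j : Fin n₂ => Fin.natAdd n₁ j ∈ J), d (Fin.natAdd n₁ j)), ?_, hd.symm⟩
      refine Finset.mem_product.2 ⟨?_, ?_⟩
      · exact Finset.mem_image.2 ⟨(Finset.univ.filter fun j : Fin n₁ => Fin.castAdd n₂ j ∈ J),
          Finset.mem_filter.2 ⟨Finset.mem_univ _, rfl⟩, rfl⟩
      · refine Finset.mem_image.2 ⟨(Finset.univ.filter fun j : Fin n₂ => Fin.natAdd n₁ j ∈ J),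
          Finset.mem_filter.2 ⟨Finset.mem_univ _, ?_⟩, rfl⟩
        omega
  · intro hp
    obtain ⟨v₁, hv₁, hp⟩ := Finset.mem_biUnion.1 hp
    obtain ⟨pq, hpq, rfl⟩ := Finset.mem_image.1 hp
    obtain ⟨h1, h2⟩ := Finset.mem_product.1 hpq
    obtain ⟨J₁, hJ₁, hq1⟩ := Finset.mem_image.1 h1
    obtain ⟨J₂, hJ₂, hq2⟩ := Finset.mem_image.1 h2
    have hw₁ : ∑ j ∈ J₁, g (Fin.castAdd n₂ j) = v₁ := (Finset.mem_filter.1 hJ₁).2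
    have hw₂ : ∑ j ∈ J₂, g (Fin.natAdd n₁ j) = v - v₁ := (Finset.mem_filter.1 hJ₂).2
    have hle : v₁ ≤ v := Nat.lt_succ_iff.1 (Finset.mem_range.1 hv₁)
    refine Finset.mem_image.2 ⟨J₁.map (Fin.castAddEmb n₂) ∪ J₂.map (Fin.natAddEmb n₁), ?_, ?_⟩
    · refine Finset.mem_filter.2 ⟨Finset.mem_univ _, ?_⟩
      rw [sum_glue, hw₁, hw₂]
      omega
    · rw [sum_glue, hq1, hq2]

end Summit.ValiantsHypothesis.ValiantsHypothesis.Theorems.NewtonUnitEquationsNewtonTauWeak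

end
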